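import Summits.FinalStateConjecture.FinalStateConjecture.Cruxes.HonestFixedRadiusSettling.Disproof

/-!
# Sanity for line `sojourn-needs-only-one-over-delta`: ONE ATLAS AT INFINITY holds at the Minkowski
development of the trivial data (Disproof §6: `𝒟₀`, `d₀`) with `M = a = r₁ = 0`, `φ` = the inclusion
`Kerr.slice 0 0 ↪ Minkowski.slice`, `R♯ ≡ 1`, `B♯` = the closed 2-ball, `κ = 1`.

(Evidence file, planner-cruxplan-stmt-FinalStateConjecture-13550-sojourn-needs-only-o-0, 2026-08-16. It imports the
standing disprover's module for `d₀`; the Lines skeleton itself does not. The predicate below is a VERBATIM copy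
of `Lines/sojourn-needs-only-one-over-delta.lean`'s `OneAtlasAtInfinity` with its three auxiliary definitions.)
-/

noncomputable section

set_option linter.dupNamespace false

open Literature.Geometry.Lorentzian
open scoped Manifold ContDiff ENNReal Topology
open Filter Set MeasureTheory Topology TopologicalSpace

namespace Summit.FinalStateConjecture.FinalStateConjecture.Cruxes.HonestFixedRadiusSettling.SojournNeedsOnlyOneOverDelta.Sanity

open Summit.FinalStateConjecture.FinalStateConjecture.Cruxes.HonestFixedRadiusSettling.Disproof

/-! ## Verbatim copies from the Lines file -/

def blHeight (M a : ℝ) (r : ℝ) : ℝ :=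
  Real.smoothTransition (r / (4 * M) - 1) *
    ((M / Real.sqrt (M ^ 2 - a ^ 2)) *
        (Kerr.rPlus M a * Real.log (r - Kerr.rPlus M a) - Kerr.rMinus M a * Real.log (r - Kerr.rMinus M a)) -
      (M / Real.sqrt (M ^ 2 - a ^ 2)) *
        (Kerr.rPlus M a * Real.log (4 * M - Kerr.rPlus M a) - Kerr.rMinus M a * Real.log (4 * M - Kerr.rMinus M a)))

def blToKS (M a : ℝ) (y : E4) : E4 :=
  E4.ofTimeSpace (y 0 + blHeight M a (Kerr.radius a (E4.ofTimeSpace 0 (E4.spatial y)))) (E4.spatial y)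

def kerrBL (M a : ℝ) (y : E4) : E4 →L[ℝ] E4 →L[ℝ] ℝ :=
  (Kerr.bilin M a (blToKS M a y)).bilinearComp (fderiv ℝ (blToKS M a) y) (fderiv ℝ (blToKS M a) y)

section OneAtlas

variable {X : Type} [TopologicalSpace X] [ChartedSpace E3 X] [IsManifold (𝓡 3) ∞ X] [ConnectedSpace X]
  {D : InitialDataSet (𝓡 3) X}

def OneAtlasAtInfinity (𝒟 : VacuumCauchyDevelopment D) {O : Set 𝒟.carrier} {k : ℕ}
    (d : FinalStateDecomposition 𝒟.toSpacetime O k) (M a r₁ : ℝ) (φ : Kerr.slice a r₁ → X)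
    (Rs : ℝ → ℝ) (Bs : Set X) (κ : ℝ) : Prop :=
  IsCompact Bs ∧ 0 < κ ∧ 0 ≤ M ∧ |a| ≤ M ∧ Continuous Rs ∧ (∀ t, 16 * M + |a| + 1 ≤ Rs t) ∧
  (∀ t t' : ℝ, 0 ≤ t → t ≤ t' → Rs t' ≤ Rs t + 2 * (t' - t)) ∧
  ({y : E4 | -1 < y 0 ∧ Rs (y 0) < E4.spatialNorm y} ⊆ (d.flatDomain : Set E4)) ∧
  (∀ y : d.flatDomain, -1 < y.1 0 → Rs (y.1 0) < E4.spatialNorm y.1 →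
    𝒟.toSpacetime.deviation (Minkowski.backgroundOn d.flatDomain) d.flatChart y =
      kerrBL M a y.1 - Minkowski.bilin) ∧
  (∀ y : d.flatDomain, -1 < y.1 0 → Rs (y.1 0) < E4.spatialNorm y.1 →
    𝒟.timeOrientation.IsFutureDirected (mfderiv 𝓘(ℝ, E4) (𝓡 4) d.flatChart y (E4.basisVector 0))) ∧
  Set.InjOn d.flatChart {y : d.flatDomain | 0 ≤ y.1 0} ∧
  IsOpenEmbedding φ ∧ ContMDiff 𝓘(ℝ, E3) (𝓡 3) ∞ φ ∧
  (∀ ρ : ℝ, IsCompact (φ '' {x : Kerr.slice a r₁ | ρ < ‖(x : E3)‖})ᶜ) ∧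
  (∀ (x : Kerr.slice a r₁) (hx : E4.ofTimeSpace 0 (x : E3) ∈ d.flatDomain), Rs 0 < ‖(x : E3)‖ →
    d.flatChart ⟨E4.ofTimeSpace 0 (x : E3), hx⟩ = 𝒟.embed (φ x)) ∧
  (𝒟.metric.causalFuture 𝒟.timeOrientation (range 𝒟.embed) ⊆
    𝒟.metric.causalFuture 𝒟.timeOrientation (𝒟.embed '' Bs) ∪
      d.flatChart '' {y : d.flatDomain | 0 ≤ y.1 0 ∧ Rs (y.1 0) < E4.spatialNorm y.1}) ∧
  (∀ (i : Fin d.N) (z : E4), d.τ₀ ≤ z 0 →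
    Kerr.radius (d.spin i) (poincareInv (d.motion i).1 (d.motion i).2 z) ≤ d.excision i (z 0) →
      E4.spatialNorm z + κ * z 0 ≤ Rs (z 0))

end OneAtlas

/-! ## The Minkowski instance -/

theorem blHeight_zero_mass (a r : ℝ) : blHeight 0 a r = 0 := by
  simp [blHeight]

theorem blToKS_zero_mass (a : ℝ) : blToKS 0 a = id := by
  funext y
  simp only [blToKS, blHeight_zero_mass, add_zero, id]
  exact E4.ofTimeSpace_time_spatial y

theorem kerrBL_zero_mass (a : ℝ) (y : E4) : kerrBL 0 a y = Minkowski.bilin := by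
  simp only [kerrBL, blToKS_zero_mass, Kerr.bilin_zero_left, fderiv_id]
  ext v w
  simp

/-- `Kerr.slice 0 0 ≤ ⊤ = Minkowski.slice`. -/
theorem slice_le_top : Kerr.slice 0 0 ≤ (Minkowski.slice : Opens E3) := le_top

/-- The end attachment: the inclusion of the punctured `t* = 0` leaf into the Minkowski slice. -/
def φ₀ : Kerr.slice 0 0 → Minkowski.slice := Opens.inclusion slice_le_top

/-- The compact core: the closed ball of radius `2`. -/
def B₂ : Set Minkowski.slice := {x | ‖(x : E3)‖ ≤ 2}

theorem isCompact_B₂ : IsCompact B₂ := by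
  rw [Subtype.isCompact_iff]
  have : ((↑) : Minkowski.slice → E3) '' B₂ = Metric.closedBall (0 : E3) 2 := by
    ext x
    simp only [B₂, mem_image, mem_setOf_eq, Metric.mem_closedBall, dist_zero_right]
    constructor
    · rintro ⟨y, hy, rfl⟩; exact hy
    · intro hx; exact ⟨⟨x, trivial⟩, hx, rfl⟩
  rw [this]
  exact isCompact_closedBall _ _

/-- The far sets of `φ₀` have compact complements: the complement of `φ₀ {ρ < ‖x‖}` is the closed ball of radius
`max ρ 0` (the puncture `{0} = E3 ∖ Kerr.slice 0 0` included). -/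
theorem val_image_compl_image_φ₀ (ρ : ℝ) :
    ((↑) : Minkowski.slice → E3) '' (φ₀ '' {x : Kerr.slice 0 0 | ρ < ‖(x : E3)‖})ᶜ =
      Metric.closedBall (0 : E3) (max ρ 0) := by
  ext z
  simp only [mem_image, mem_compl_iff, mem_setOf_eq, Metric.mem_closedBall, dist_zero_right]
  constructor
  · rintro ⟨y, hy, rfl⟩
    by_contra hlt
    push Not at hlt
    apply hy
    have hy0 : 0 < ‖(y : E3)‖ := lt_of_le_of_lt (le_max_right _ _) hlt
    have hyρ : ρ < ‖(y : E3)‖ := lt_of_le_of_lt (le_max_left _ _) hlt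
    have hmem : (y : E3) ∈ Kerr.slice 0 0 := by
      rw [Kerr.mem_slice, Kerr.radius_zero_left, E4.spatialNorm_ofTimeSpace, max_self]
      exact hy0
    exact ⟨⟨(y : E3), hmem⟩, hyρ, rfl⟩
  · intro hz
    refine ⟨⟨z, trivial⟩, ?_, rfl⟩
    rintro ⟨x, hx, hxz⟩
    have hxz' : (x : E3) = z := congrArg Subtype.val hxz
    have hx0 : 0 < ‖(x : E3)‖ := by
      have h2 := x.2
      rw [Kerr.mem_slice, Kerr.radius_zero_left, E4.spatialNorm_ofTimeSpace, max_self] at h2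
      exact h2
    rw [hxz'] at hx hx0
    rcases le_total ρ 0 with hρ | hρ
    · rw [max_eq_right hρ] at hz
      linarith
    · rw [max_eq_left hρ] at hz
      linarith

theorem isCompact_compl_image_φ₀ (ρ : ℝ) :
    IsCompact (φ₀ '' {x : Kerr.slice 0 0 | ρ < ‖(x : E3)‖})ᶜ := by
  rw [Subtype.isCompact_iff, val_image_compl_image_φ₀]
  exact isCompact_closedBall _ _

/-- **ONE ATLAS AT INFINITY for Minkowski space** (the `M = 0` column; anti-vacuity of the predicate and the
Disproof-§6 instance of the line): every clause holds at `(𝒟₀, d₀)` with the identity flat chart. -/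
theorem oneAtlasAtInfinity_minkowski :
    OneAtlasAtInfinity 𝒟₀ d₀ 0 0 0 φ₀ (fun _ ↦ 1) B₂ 1 := by
  refine ⟨isCompact_B₂, one_pos, le_rfl, by simp, continuous_const, fun t ↦ by simp, fun t t' ht htt' ↦ by linarith,
    fun _ _ ↦ trivial, ?_, ?_, ?_, ?_, ?_, isCompact_compl_image_φ₀, ?_, ?_, ?_⟩
  · -- EXACT: the identity chart has deviation 0 = kerrBL 0 0 − η
    intro y _ _
    refine (Minkowski.deviation_vacuumCauchyDevelopment_subtypeVal y).trans ?_
    rw [kerrBL_zero_mass]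
    exact (sub_self (Minkowski.bilin : E4 →L[ℝ] E4 →L[ℝ] ℝ)).symm
  · -- ORIENTED: dι(∂₀) = ∂₀ is future-directed
    intro y _ _
    have h := OpensChart.mfderiv_subtypeVal_apply (U := (⊤ : Opens E4)) y (E4.basisVector 0)
    show 𝒟₀.timeOrientation.IsFutureDirected
      (mfderiv 𝓘(ℝ, E4) 𝓘(ℝ, E4) (Subtype.val : (⊤ : Opens E4) → E4) y (E4.basisVector 0))
    rw [h]
    exact 𝒟₀.timeOrientation.isFutureDirected_vectorField y.1
  · -- INJECTIVE
    intro y _ y' _ h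
    exact Subtype.ext h
  · -- φ₀ is an open embedding
    exact TopologicalSpace.Opens.isOpenEmbedding_of_le slice_le_top
  · -- φ₀ is smooth
    exact contMDiff_inclusion slice_le_top
  · -- ATTACHED: ι(φ₀ x) = (0, x) = the identity chart at (0, x)
    intro x hx _
    rfl
  · -- COVER: J⁺({x⁰ = 0}) = {x⁰ ≥ 0} ⊆ J⁺(ι B₂) ∪ {x⁰ ≥ 0, |x⃗| > 1}
    have key : 𝒟₀.metric.causalFuture 𝒟₀.timeOrientation (range 𝒟₀.embed) = ({x : E4 | 0 ≤ x 0} : Set E4) := by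
      rw [range_embed]
      exact causalFuture_hyperplane
    intro q hq
    rw [key] at hq
    have hq0 : 0 ≤ E4.time q := hq
    by_cases hfar : 1 < E4.spatialNorm q
    · exact Or.inr ⟨⟨q, trivial⟩, ⟨hq0, hfar⟩, rfl⟩
    · left
      push Not at hfar
      have hp : E4.ofTimeSpace 0 (E4.spatial q) ∈ 𝒟₀.embed '' B₂ := by
        refine ⟨⟨E4.spatial q, trivial⟩, ?_, rfl⟩
        show ‖E4.spatial q‖ ≤ 2
        have : E4.spatialNorm q = ‖E4.spatial q‖ := rfl
        linarith
      have hqp : (q : 𝒟₀.carrier) ∈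
          𝒟₀.metric.causalFuture 𝒟₀.timeOrientation {E4.ofTimeSpace 0 (E4.spatial q)} := by
        have h' : ‖E4.spatial q - E4.spatial (E4.ofTimeSpace 0 (E4.spatial q))‖ ≤
            E4.time q - (E4.ofTimeSpace 0 (E4.spatial q)) 0 := by
          rw [E4.spatial_ofTimeSpace, sub_self, norm_zero, E4.ofTimeSpace_apply_zero, sub_zero]
          exact hq0
        exact (Set.ext_iff.mp (Minkowski.causalFuture_singleton (E4.ofTimeSpace 0 (E4.spatial q))) q).mpr h'
      exact LorentzianMetric.causalFuture_mono (g := 𝒟₀.metric) (τ := 𝒟₀.timeOrientation)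
        (singleton_subset_iff.mpr hp) hqp
  · -- SEPARATED: no holes
    haveI : IsEmpty (Fin d₀.N) := d₀_N ▸ Fin.isEmpty'
    intro i
    exact (IsEmpty.false i).elim

end Summit.FinalStateConjecture.FinalStateConjecture.Cruxes.HonestFixedRadiusSettling.SojournNeedsOnlyOneOverDelta.Sanity

end
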